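import Literature.Analysis.FluidPDE.NSBoundedMildOseenIntegral
import Literature.Analysis.FluidPDE.NSBoundedMildOseenRestart
import Literature.Analysis.FluidPDE.NSBoundedMildSmoothing
import Literature.Analysis.FluidPDE.NSBoundedMildOseenClassical
import Literature.Analysis.FluidPDE.NSCriticalClosureBesovAssembly
import HarnessLib

/-!
# Classical smoothness of bounded Besov mild solutions: the dependency record after (A), (R), (C)

Analysis/FluidPDE assembly file (proofs only, no new definitions or named facts) for the named
fact `Literature.Analysis.FluidPDE.knss_classical_of_bounded_isBesovMildSolutionOn`
(`NSCriticalClosureBesovBounded.lean`; Koch–Nadirashvili–Seregin–Šverák 2009, §4 with Prop. 4.1: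
a Besov mild solution of Navier–Stokes on `[0, T)` whose slices are uniformly essentially bounded
on every `(0, T₁)`, `T₁ < T`, agrees a.e. with a classical solution `(v, π)` on `(0, T)`).

`NSBoundedMildOseen.lean` reduced the fact to four named facts on the Oseen-kernel architecture
(`knss_classical_of_bounded_isBesovMildSolutionOn_of_oseen`):

* (A) `oseenMild_of_bounded_isBesovMildSolutionOn` — duality form ⇒ Oseen integral form;
  **discharged**: `oseenMild_of_bounded_isBesovMildSolutionOn_holds`
  (`NSBoundedMildOseenIntegral.lean`, on `NSBoundedMildOseenDuhamel.lean` and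
  `OseenDuhamelLowFrequency.lean`);
* (R) `oseenMild_restart` — restart of the integral equation; **discharged**:
  `oseenMild_restart_holds` (`NSBoundedMildOseenRestart.lean`, on `OseenKernelSemigroup.lean`);
* (P) `knss2009_smoothing` — KNSS Prop. 4.1; **reduced** to the local theory
  (L) `knss2009_local_smoothing` by `knss2009_smoothing_of_local`
  (`NSBoundedMildSmoothing.lean`, with (R) and the uniqueness of bounded solutions,
  `OseenMildUniqueness.lean`);
* (C) `classical_of_smooth_isMildNSSolutionOn` — smooth mild solutions are classical;
  **discharged**: `classical_of_smooth_isMildNSSolutionOn_holds`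
  (`NSBoundedMildOseenClassical.lean`).

This file feeds the three discharges and the reduction of (P) in, so that the dependency record
of the fact is now the **single** named fact (L) `knss2009_local_smoothing ℝ³` (KNSS 2009,
Prop. 4.1 in its quantitative short-time form: smooth local solutions from bounded data with
the parabolic smoothing estimates (4.5)):
`knss_classical_of_bounded_isBesovMildSolutionOn_of_local`. Correspondingly, the critical Besov
continuation criterion `hasSmoothExtensionPast_of_eHomBesovNorm_bounded` (Gallagher–Koch–Planchon
2016, Thm. 1, contrapositive; `NSCriticalClosureBesovBounded.lean`,
`NSCriticalClosureBesovAssembly.lean`) now rests on GKP Thm. 1, the two Tao 2013 facts, and (L):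
`hasSmoothExtensionPast_of_eHomBesovNorm_bounded_of_gkp_tao_local`.

Kept in a separate leaf file so that the proof imports of the four discharge files stay out of
the statement/decomposition files.

## Mathlib / tree search

Tree (`lean search '_holds' | grep NSBoundedMild`, `lean search knss2009_local_smoothing`): the
four theorems fed in above and `knss2009_smoothing_of_local`; nothing else proves or assumes
`knss_classical_of_bounded_isBesovMildSolutionOn` besides the GKP assembly files. Mathlib: none
(no Navier–Stokes theory).

## References

* G. Koch, N. Nadirashvili, G. Seregin, V. Šverák, *Liouville theorems for the Navier–Stokes
  equations and applications*, Acta Math. 203 (2009) 83–105 = arXiv:0709.3599, §4 p. 8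
  (mild solutions (4.3)–(4.4), Prop. 4.1 and (4.5)). [KochNadirashviliSereginSverak2009]
* I. Gallagher, G. S. Koch, F. Planchon, Comm. Math. Phys. 343 (2016) 39–82 = arXiv:1407.4156,
  Thm. 1. [GKP2016]
* P. G. Lemarié-Rieusset, *The Navier–Stokes problem in the 21st century*, CRC Press 2016,
  Thm. 6.1 and Thm. 9.12. [LemarieRieusset2016]
-/

noncomputable section

namespace Literature.Analysis.FluidPDE

/-- **KNSS Prop. 4.1 on `ℝ³` from the local theory**: the named fact (P)
`knss2009_smoothing ℝ³` follows from (L) `knss2009_local_smoothing ℝ³`, the restart fact (R)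
being discharged (`oseenMild_restart_holds`). [cite: KochNadirashviliSereginSverak2009, Prop. 4.1 (arXiv:0709.3599 p. 8)] -/
theorem knss2009_smoothing_three_of_local
    (hL : knss2009_local_smoothing (EuclideanSpace ℝ (Fin 3))) :
    knss2009_smoothing (EuclideanSpace ℝ (Fin 3)) :=
  knss2009_smoothing_of_local (oseenMild_restart_holds (EuclideanSpace ℝ (Fin 3))) hL

/-- **Classical smoothness of bounded Besov mild solutions from the local theory alone.** With
(A), (R), (C) discharged and (P) reduced to (L), the fact
`knss_classical_of_bounded_isBesovMildSolutionOn` (KNSS 2009, §4 with Prop. 4.1) follows from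
the single named fact (L) `knss2009_local_smoothing ℝ³` (KNSS 2009, Prop. 4.1, short-time
quantitative form). [cite: KochNadirashviliSereginSverak2009, §4 with Prop. 4.1 (arXiv:0709.3599 p. 8)] -/
theorem knss_classical_of_bounded_isBesovMildSolutionOn_of_local
    (hL : knss2009_local_smoothing (EuclideanSpace ℝ (Fin 3))) :
    knss_classical_of_bounded_isBesovMildSolutionOn :=
  knss_classical_of_bounded_isBesovMildSolutionOn_of_oseen
    oseenMild_of_bounded_isBesovMildSolutionOn_holds (oseenMild_restart_holds (EuclideanSpace ℝ (Fin 3)))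
    (knss2009_smoothing_of_local (oseenMild_restart_holds (EuclideanSpace ℝ (Fin 3))) hL)
    (classical_of_smooth_isMildNSSolutionOn_holds (E := (EuclideanSpace ℝ (Fin 3))))

/-- **The critical Besov continuation criterion from GKP Thm. 1, the two Tao 2013 facts and the
KNSS local theory (L)** (Gallagher–Koch–Planchon 2016, Thm. 1, contrapositive):
`hasSmoothExtensionPast_of_eHomBesovNorm_bounded_of_gkp_tao_knss` with the KNSS smoothing fact
supplied by `knss_classical_of_bounded_isBesovMildSolutionOn_of_local`. [cite: GKP2016, Thm. 1] -/
theorem hasSmoothExtensionPast_of_eHomBesovNorm_bounded_of_gkp_tao_local (hG : gkp_besov_blowup)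
    (h₁ : tao2011_hasBoundedSobolevNormsOn) (hTao : tao2011_smooth_local_existence)
    (hL : knss2009_local_smoothing (EuclideanSpace ℝ (Fin 3))) :
    hasSmoothExtensionPast_of_eHomBesovNorm_bounded :=
  hasSmoothExtensionPast_of_eHomBesovNorm_bounded_of_gkp_tao_knss hG h₁ hTao
    (knss_classical_of_bounded_isBesovMildSolutionOn_of_local hL)

/-- **The route's dependency record, updated**: `hasSmoothExtensionPast_of_eHomBesovNorm_bounded`
holds as soon as GKP Thm. 1, the two Tao 2013 facts and the KNSS local theory (L) are
discharged; stated as the implication from their conjunction. [cite: GKP2016, Thm. 1] -/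
theorem hasSmoothExtensionPast_of_eHomBesovNorm_bounded_of_and_local
    (h : gkp_besov_blowup ∧ tao2011_hasBoundedSobolevNormsOn ∧ tao2011_smooth_local_existence ∧
      knss2009_local_smoothing (EuclideanSpace ℝ (Fin 3))) :
    hasSmoothExtensionPast_of_eHomBesovNorm_bounded :=
  hasSmoothExtensionPast_of_eHomBesovNorm_bounded_of_gkp_tao_local h.1 h.2.1 h.2.2.1 h.2.2.2

end Literature.Analysis.FluidPDE

end
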